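import Summits.QuantumFields.YangMills.Theorems.SteinGapBootstrapFreeProbeLawGAssemblyCore
import Literature.MathematicalPhysics.QuantumFieldTheory.LatticeMaxwellBlockGaussianIBP
import HarnessLib

/-!
# Crux U `FreeProbeLawG` (stmt-QuantumFields-23756), line `birth` — assembly part A3b: the generator step

Lead `ym-line-sgb-k1-g1`; helper toward the registered stub `stub_assembly`. With the resummed Schwinger–Dyson identity
(`AssemblyCore.resummed_sd`) applied to the test functions `g_s = ∂_s F ∘ restrict` (`s = (p, a)`, `F ∈ C²` on the pair-block space with
`‖DF‖ ≤ 1` and `DF` `M`-Lipschitz) and one truncated Green `1`-form `ω_p` per block plaquette `p` whose curl reproduces the block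
covariance EXACTLY on the block (`(dω_p)(q) = curvatureTwoPoint p q`, `q ∈ B`), the Ornstein–Uhlenbeck generator discrepancy splits as
`E_μ[L_B F(Y_B)] = Σ_s ( [resummed SD error of g_s] − E_μ[∂_s F(Y_B) · X_s] )`, `X_s = Y_p^a − ⟨dω_p, Y^a⟩_S` the harmonic background;
hence `|E_μ L_B F(Y_B)| ≤ Σ_{s} (‖ω_p‖₁ εsd (1 + M) + E_μ|X_s|)` (`abs_integral_generator_le`).
HONEST LABEL: RECORD rung R2ξ-G only; nothing here bears on the Yang–Mills mass gap.
References: E. Meckes, IMS Coll. 5 (2009), Lemma 1 [Meckes2009]; S. Chatterjee, arXiv:1602.01222, §11 [arXiv160201222].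
-/

set_option autoImplicit false

noncomputable section

open MeasureTheory Finset
open Literature.Probability.LatticeModels Literature.MathematicalPhysics.QuantumLattice
open Literature.MathematicalPhysics.QuantumFieldTheory hiding ZdEdge IsLocalObservable IsInfiniteVolumeLimit
open Summit.QuantumFields.YangMills.Theorems.EquipartitionPinsProbe

namespace Summit.QuantumFields.YangMills.Cruxes.FreeProbeLawG.SteinFree

namespace AssemblyGen

/-! The block-space linear algebra (`sum_smul_latticeMaxwellBlockBasis`, `fderiv_apply_self_eq_sum`,
`norm_latticeMaxwellBlockBasis_le`) is imported from `Literature…LatticeMaxwellBlockGaussianIBP`. -/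

/-! ### The restriction map `S → B` and the test functions `g_s = ∂_s F ∘ restrict` -/

section Restrict

variable {d : ℕ} {S B : Finset (ZdPlaquette d)} (hBS : B ⊆ S) (D : ℕ)

/-! The restriction of block coordinates from `S` to `B ⊆ S` is the continuous linear map
`ContinuousLinearMap.pi fun q : ↥B => ContinuousLinearMap.proj ⟨q.1, hBS q.2⟩` (written out inline; no definition is introduced). -/

/-- The restriction map evaluated. -/
theorem restrictCLM_apply (y : ↥S → Fin D → ℝ) (q : ↥B) (b : Fin D) :
    (ContinuousLinearMap.pi fun q : ↥B =>
        ContinuousLinearMap.proj (R := ℝ) (φ := fun _ : ↥S => Fin D → ℝ) ⟨q.1, hBS q.2⟩) y q b = y ⟨q.1, hBS q.2⟩ b := rfl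

/-- The restriction map does not increase the sup norm. -/
theorem norm_restrictCLM_le :
    ‖(ContinuousLinearMap.pi fun q : ↥B =>
        ContinuousLinearMap.proj (R := ℝ) (φ := fun _ : ↥S => Fin D → ℝ) ⟨q.1, hBS q.2⟩)‖ ≤ 1 := by
  refine ContinuousLinearMap.opNorm_le_bound _ zero_le_one fun y => ?_
  rw [one_mul]
  refine (pi_norm_le_iff_of_nonneg (norm_nonneg _)).2 fun q => ?_
  exact norm_le_pi_norm y ⟨q.1, hBS q.2⟩

end Restrict

section TestFunctions

variable {d : ℕ} {S B : Finset (ZdPlaquette d)} (hBS : B ⊆ S) {D : ℕ}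
  {F : (↥B → Fin D → ℝ) → ℝ} {M : ℝ}

/-- `h_s = DF(·)[e_s]` is `C¹`, bounded by `1` and has derivative of norm `≤ M`. -/
theorem partial_props (hF : ContDiff ℝ 2 F) (hF1 : ∀ x, ‖fderiv ℝ F x‖ ≤ 1) (hM : 0 ≤ M)
    (hF2 : ∀ x y, ‖fderiv ℝ F x - fderiv ℝ F y‖ ≤ M * ‖x - y‖) (s : ↥B × Fin D) :
    ContDiff ℝ 1 (fun y => fderiv ℝ F y (latticeMaxwellBlockBasis B D s)) ∧
      (∀ y, |fderiv ℝ F y (latticeMaxwellBlockBasis B D s)| ≤ 1) ∧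
      (∀ y, ‖fderiv ℝ (fun y => fderiv ℝ F y (latticeMaxwellBlockBasis B D s)) y‖ ≤ M) := by
  have he := norm_latticeMaxwellBlockBasis_le B D s
  refine ⟨?_, ?_, ?_⟩
  · have h2 : ContDiff ℝ (1 + 1) F := hF
    rw [contDiff_succ_iff_fderiv_apply] at h2
    exact h2.2.2 _
  · intro y
    rw [← Real.norm_eq_abs]
    calc ‖fderiv ℝ F y (latticeMaxwellBlockBasis B D s)‖ ≤ ‖fderiv ℝ F y‖ * ‖latticeMaxwellBlockBasis B D s‖ :=
          ContinuousLinearMap.le_opNorm _ _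
      _ ≤ 1 * 1 := mul_le_mul (hF1 y) he (norm_nonneg _) zero_le_one
      _ = 1 := one_mul _
  · intro y
    have hlip : LipschitzWith ⟨M, hM⟩ (fun y => fderiv ℝ F y (latticeMaxwellBlockBasis B D s)) := by
      refine LipschitzWith.of_dist_le_mul fun x z => ?_
      rw [dist_eq_norm, dist_eq_norm]
      calc ‖fderiv ℝ F x (latticeMaxwellBlockBasis B D s) - fderiv ℝ F z (latticeMaxwellBlockBasis B D s)‖
          = ‖(fderiv ℝ F x - fderiv ℝ F z) (latticeMaxwellBlockBasis B D s)‖ := rfl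
        _ ≤ ‖fderiv ℝ F x - fderiv ℝ F z‖ * ‖latticeMaxwellBlockBasis B D s‖ := ContinuousLinearMap.le_opNorm _ _
        _ ≤ M * ‖x - z‖ * 1 := mul_le_mul (hF2 x z) he (norm_nonneg _) (by positivity)
        _ = (⟨M, hM⟩ : NNReal) * ‖x - z‖ := by simp
    exact norm_fderiv_le_of_lipschitz ℝ hlip

/-- `g_s = h_s ∘ restrict` is `C¹`, bounded by `1`, with `‖D g_s‖ ≤ M`, and its derivative along `v` is `D h_s(restrict y)[restrict v]`. -/
theorem testFun_props (hF : ContDiff ℝ 2 F) (hF1 : ∀ x, ‖fderiv ℝ F x‖ ≤ 1) (hM : 0 ≤ M)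
    (hF2 : ∀ x y, ‖fderiv ℝ F x - fderiv ℝ F y‖ ≤ M * ‖x - y‖) (s : ↥B × Fin D) :
    ContDiff ℝ 1 (fun y : ↥S → Fin D → ℝ => fderiv ℝ F ((ContinuousLinearMap.pi fun q : ↥B => ContinuousLinearMap.proj (R := ℝ) (φ := fun _ : ↥S => Fin D → ℝ) ⟨q.1, hBS q.2⟩) y) (latticeMaxwellBlockBasis B D s)) ∧
      (∀ y : ↥S → Fin D → ℝ, |fderiv ℝ F ((ContinuousLinearMap.pi fun q : ↥B => ContinuousLinearMap.proj (R := ℝ) (φ := fun _ : ↥S => Fin D → ℝ) ⟨q.1, hBS q.2⟩) y) (latticeMaxwellBlockBasis B D s)| ≤ 1) ∧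
      (∀ y : ↥S → Fin D → ℝ,
        ‖fderiv ℝ (fun y : ↥S → Fin D → ℝ => fderiv ℝ F ((ContinuousLinearMap.pi fun q : ↥B => ContinuousLinearMap.proj (R := ℝ) (φ := fun _ : ↥S => Fin D → ℝ) ⟨q.1, hBS q.2⟩) y) (latticeMaxwellBlockBasis B D s)) y‖ ≤ M) ∧
      (∀ y v : ↥S → Fin D → ℝ,
        fderiv ℝ (fun y : ↥S → Fin D → ℝ => fderiv ℝ F ((ContinuousLinearMap.pi fun q : ↥B => ContinuousLinearMap.proj (R := ℝ) (φ := fun _ : ↥S => Fin D → ℝ) ⟨q.1, hBS q.2⟩) y) (latticeMaxwellBlockBasis B D s)) y v =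
          fderiv ℝ (fun y' => fderiv ℝ F y' (latticeMaxwellBlockBasis B D s)) ((ContinuousLinearMap.pi fun q : ↥B => ContinuousLinearMap.proj (R := ℝ) (φ := fun _ : ↥S => Fin D → ℝ) ⟨q.1, hBS q.2⟩) y) ((ContinuousLinearMap.pi fun q : ↥B => ContinuousLinearMap.proj (R := ℝ) (φ := fun _ : ↥S => Fin D → ℝ) ⟨q.1, hBS q.2⟩) v)) := by
  obtain ⟨h1, h2, h3⟩ := partial_props hF hF1 hM hF2 s
  set h : (↥B → Fin D → ℝ) → ℝ := fun y' => fderiv ℝ F y' (latticeMaxwellBlockBasis B D s) with hh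
  have hcomp : (fun y : ↥S → Fin D → ℝ => fderiv ℝ F ((ContinuousLinearMap.pi fun q : ↥B => ContinuousLinearMap.proj (R := ℝ) (φ := fun _ : ↥S => Fin D → ℝ) ⟨q.1, hBS q.2⟩) y) (latticeMaxwellBlockBasis B D s)) =
      h ∘ (ContinuousLinearMap.pi fun q : ↥B => ContinuousLinearMap.proj (R := ℝ) (φ := fun _ : ↥S => Fin D → ℝ) ⟨q.1, hBS q.2⟩) := rfl
  have hfd : ∀ y, fderiv ℝ (h ∘ (ContinuousLinearMap.pi fun q : ↥B => ContinuousLinearMap.proj (R := ℝ) (φ := fun _ : ↥S => Fin D → ℝ) ⟨q.1, hBS q.2⟩)) y = (fderiv ℝ h ((ContinuousLinearMap.pi fun q : ↥B => ContinuousLinearMap.proj (R := ℝ) (φ := fun _ : ↥S => Fin D → ℝ) ⟨q.1, hBS q.2⟩) y)).comp ((ContinuousLinearMap.pi fun q : ↥B => ContinuousLinearMap.proj (R := ℝ) (φ := fun _ : ↥S => Fin D → ℝ) ⟨q.1, hBS q.2⟩)) := fun y =>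
    fderiv_comp y ((h1.differentiable one_ne_zero) _) ((ContinuousLinearMap.pi fun q : ↥B => ContinuousLinearMap.proj (R := ℝ) (φ := fun _ : ↥S => Fin D → ℝ) ⟨q.1, hBS q.2⟩)).differentiableAt |>.trans
      (by rw [ContinuousLinearMap.fderiv])
  refine ⟨?_, fun y => h2 _, fun y => ?_, fun y v => ?_⟩
  · rw [hcomp]; exact h1.comp ((ContinuousLinearMap.pi fun q : ↥B => ContinuousLinearMap.proj (R := ℝ) (φ := fun _ : ↥S => Fin D → ℝ) ⟨q.1, hBS q.2⟩)).contDiff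
  · rw [hcomp, hfd]
    calc ‖(fderiv ℝ h ((ContinuousLinearMap.pi fun q : ↥B => ContinuousLinearMap.proj (R := ℝ) (φ := fun _ : ↥S => Fin D → ℝ) ⟨q.1, hBS q.2⟩) y)).comp ((ContinuousLinearMap.pi fun q : ↥B => ContinuousLinearMap.proj (R := ℝ) (φ := fun _ : ↥S => Fin D → ℝ) ⟨q.1, hBS q.2⟩))‖
        ≤ ‖fderiv ℝ h ((ContinuousLinearMap.pi fun q : ↥B => ContinuousLinearMap.proj (R := ℝ) (φ := fun _ : ↥S => Fin D → ℝ) ⟨q.1, hBS q.2⟩) y)‖ * ‖(ContinuousLinearMap.pi fun q : ↥B => ContinuousLinearMap.proj (R := ℝ) (φ := fun _ : ↥S => Fin D → ℝ) ⟨q.1, hBS q.2⟩)‖ := ContinuousLinearMap.opNorm_comp_le _ _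
      _ ≤ M * 1 := mul_le_mul (h3 _) (norm_restrictCLM_le hBS D) (norm_nonneg _) hM
      _ = M := mul_one _
  · rw [hcomp, hfd]
    rfl

end TestFunctions

/-! ### The generator step -/

section Generator

variable {G : Type} [Group G] [TopologicalSpace G] [IsTopologicalGroup G] [CompactSpace G]
  [MeasurableSpace G] [BorelSpace G] [SecondCountableTopology G]

/-- **The generator step.** See the module docstring. `X p a U := Y_p^a(U) − Σ_{q ∈ S} (dω_p)(q) Y_q^a(U)` is the harmonic background of
the block plaquette `p`; `ξ` bounds its `L¹` norms. -/
theorem abs_integral_generator_le (r : LatticeRep G) (β : ℝ) (μ : Measure (LGConfig 4 G)) [IsFiniteMeasure μ]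
    (S B : Finset (ZdPlaquette 4)) (hBS : B ⊆ S)
    (E : ↥B → Finset (ZdEdge 4)) (ω : ↥B → ZdEdge 4 → ℝ) (hωE : ∀ p e, ω p e ≠ 0 → e ∈ E p)
    (hωB : ∀ p q : ↥B, plaquetteCurl (ω p) (q : ZdPlaquette 4) = curvatureTwoPoint (p : ZdPlaquette 4) (q : ZdPlaquette 4))
    {εsd : ℝ} (hε : 0 ≤ εsd)
    (hSD : ∀ (p : ↥B) (a : Fin (lieDim r)), ∀ e ∈ E p, ∀ (g : (↥S → Fin (lieDim r) → ℝ) → ℝ) (M : ℝ), 0 ≤ M → ContDiff ℝ 1 g →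
      (∀ y, |g y| ≤ 1) → (∀ y, ‖fderiv ℝ g y‖ ≤ M) →
      |(∑ p' : ↥S, plaquetteCurl (fun e' => if e' = e then (1 : ℝ) else 0) (p' : ZdPlaquette 4) *
            ∫ U, fderiv ℝ g (fun q b => plaqField r β U (q : ZdPlaquette 4) b)
              (fun q b => if q = p' ∧ b = a then (1 : ℝ) else 0) ∂μ) -
          ∫ U, g (fun q b => plaqField r β U (q : ZdPlaquette 4) b) *
            (∑ p' ∈ S, plaquetteCurl (fun e' => if e' = e then (1 : ℝ) else 0) p' * plaqField r β U p' a) ∂μ| ≤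
        εsd * (1 + M))
    {W : ℝ} (hW : ∀ p : ↥B, ∑ e ∈ E p, |ω p e| ≤ W)
    {ξ : ℝ} (hX : ∀ (p : ↥B) (a : Fin (lieDim r)),
      ∫ U, |plaqField r β U (p : ZdPlaquette 4) a - ∑ q ∈ S, plaquetteCurl (ω p) q * plaqField r β U q a| ∂μ ≤ ξ)
    (F : (↥B → Fin (lieDim r) → ℝ) → ℝ) {M : ℝ} (hM : 0 ≤ M) (hF : ContDiff ℝ 2 F) (hF1 : ∀ x, ‖fderiv ℝ F x‖ ≤ 1)
    (hF2 : ∀ x y, ‖fderiv ℝ F x - fderiv ℝ F y‖ ≤ M * ‖x - y‖) :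
    |∫ U, latticeMaxwellBlockGenerator B (lieDim r) F (fun p a => plaqField r β U (p : ZdPlaquette 4) a) ∂μ| ≤
      (B.card * lieDim r : ℝ) * (W * (εsd * (1 + M)) + ξ) := by
  classical
  -- notation-free abbreviations (as `have`-equations to keep statements syntactic)
  have hYc : Continuous fun U : LGConfig 4 G => (fun (q : ↥S) (b : Fin (lieDim r)) => plaqField r β U (q : ZdPlaquette 4) b) :=
    AssemblyCore.continuous_blockField r β S
  have hYBc : Continuous fun U : LGConfig 4 G => (fun (q : ↥B) (b : Fin (lieDim r)) => plaqField r β U (q : ZdPlaquette 4) b) :=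
    AssemblyCore.continuous_blockField r β B
  have hYqc : ∀ (q : ZdPlaquette 4) (a : Fin (lieDim r)), Continuous fun U : LGConfig 4 G => plaqField r β U q a := fun q a =>
    TangentPlaqFieldContinuous.continuous_plaqField_apply r β q a
  -- the restriction of `Y_S U` is `Y_B U`
  have hres : ∀ U : LGConfig 4 G, (ContinuousLinearMap.pi fun q : ↥B => ContinuousLinearMap.proj (R := ℝ) (φ := fun _ : ↥S => Fin (lieDim r) → ℝ) ⟨q.1, hBS q.2⟩) (fun (q : ↥S) (b : Fin (lieDim r)) => plaqField r β U (q : ZdPlaquette 4) b) =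
      fun (q : ↥B) (b : Fin (lieDim r)) => plaqField r β U (q : ZdPlaquette 4) b := fun U => rfl
  -- integrability via continuity on the compact configuration space
  have hint : ∀ {f : LGConfig 4 G → ℝ}, Continuous f → Integrable f μ := fun hf =>
    AssemblyCore.integrable_of_continuous_bdd μ hf
  -- the players for a fixed index `s`
  have key : ∀ s : ↥B × Fin (lieDim r),
      |(∑ t : ↥B × Fin (lieDim r), latticeMaxwellBlockCov B (lieDim r) s t *
          ∫ U, fderiv ℝ (fun y' => fderiv ℝ F y' (latticeMaxwellBlockBasis B (lieDim r) s))
            (fun (q : ↥B) (b : Fin (lieDim r)) => plaqField r β U (q : ZdPlaquette 4) b) (latticeMaxwellBlockBasis B (lieDim r) t) ∂μ) -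
        ∫ U, plaqField r β U (s.1 : ZdPlaquette 4) s.2 *
          fderiv ℝ F (fun (q : ↥B) (b : Fin (lieDim r)) => plaqField r β U (q : ZdPlaquette 4) b) (latticeMaxwellBlockBasis B (lieDim r) s) ∂μ| ≤
        W * (εsd * (1 + M)) + ξ := by
    intro s
    obtain ⟨p, a⟩ := s
    obtain ⟨hg1, hg2, hg3, hg4⟩ := testFun_props hBS (D := lieDim r) hF hF1 hM hF2 (p, a)
    -- the resummed SD identity for `g_s`
    have hR := AssemblyCore.resummed_sd r β μ S (E p) (ω p) (hωE p) a (hSD p a)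
      (fun y : ↥S → Fin (lieDim r) → ℝ => fderiv ℝ F ((ContinuousLinearMap.pi fun q : ↥B => ContinuousLinearMap.proj (R := ℝ) (φ := fun _ : ↥S => Fin (lieDim r) → ℝ) ⟨q.1, hBS q.2⟩) y) (latticeMaxwellBlockBasis B (lieDim r) (p, a)))
      one_pos hM hg1 hg2 hg3
    -- (i) the derivative side is the covariance double sum
    have hvec : (ContinuousLinearMap.pi fun q : ↥B => ContinuousLinearMap.proj (R := ℝ) (φ := fun _ : ↥S => Fin (lieDim r) → ℝ) ⟨q.1, hBS q.2⟩) (fun (q : ↥S) (b : Fin (lieDim r)) => if b = a then plaquetteCurl (ω p) (q : ZdPlaquette 4) else 0) =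
        ∑ t : ↥B × Fin (lieDim r), latticeMaxwellBlockCov B (lieDim r) (p, a) t • latticeMaxwellBlockBasis B (lieDim r) t := by
      rw [← sum_smul_latticeMaxwellBlockBasis B (lieDim r) ((ContinuousLinearMap.pi fun q : ↥B => ContinuousLinearMap.proj (R := ℝ) (φ := fun _ : ↥S => Fin (lieDim r) → ℝ) ⟨q.1, hBS q.2⟩) _)]
      refine Finset.sum_congr rfl fun t _ => ?_
      congr 1
      rw [restrictCLM_apply]
      obtain ⟨q, b⟩ := t
      rw [latticeMaxwellBlockCov_apply]
      simp only
      by_cases hb : b = a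
      · subst hb; simp [hωB p q]
      · simp [hb, Ne.symm hb]
    have hder : ∀ U : LGConfig 4 G,
        fderiv ℝ (fun y : ↥S → Fin (lieDim r) → ℝ => fderiv ℝ F ((ContinuousLinearMap.pi fun q : ↥B => ContinuousLinearMap.proj (R := ℝ) (φ := fun _ : ↥S => Fin (lieDim r) → ℝ) ⟨q.1, hBS q.2⟩) y) (latticeMaxwellBlockBasis B (lieDim r) (p, a)))
            (fun (q : ↥S) (b : Fin (lieDim r)) => plaqField r β U (q : ZdPlaquette 4) b)
            (fun (q : ↥S) (b : Fin (lieDim r)) => if b = a then plaquetteCurl (ω p) (q : ZdPlaquette 4) else 0) =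
          ∑ t : ↥B × Fin (lieDim r), latticeMaxwellBlockCov B (lieDim r) (p, a) t *
            fderiv ℝ (fun y' => fderiv ℝ F y' (latticeMaxwellBlockBasis B (lieDim r) (p, a)))
              (fun (q : ↥B) (b : Fin (lieDim r)) => plaqField r β U (q : ZdPlaquette 4) b) (latticeMaxwellBlockBasis B (lieDim r) t) := by
      intro U
      rw [hg4, hres U, hvec]
      simp only [map_sum, map_smul, smul_eq_mul]
    -- continuity of `U ↦ ∂_t ∂_s F (Y_B U)`
    obtain ⟨hh1, hh2, -⟩ := partial_props hF hF1 hM hF2 (p, a)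
    have hcts : ∀ t : ↥B × Fin (lieDim r), Continuous fun U : LGConfig 4 G =>
        fderiv ℝ (fun y' => fderiv ℝ F y' (latticeMaxwellBlockBasis B (lieDim r) (p, a)))
          (fun (q : ↥B) (b : Fin (lieDim r)) => plaqField r β U (q : ZdPlaquette 4) b) (latticeMaxwellBlockBasis B (lieDim r) t) := fun t =>
      ((hh1.continuous_fderiv one_ne_zero).comp hYBc).clm_apply continuous_const
    have hI1 : (∫ U, fderiv ℝ (fun y : ↥S → Fin (lieDim r) → ℝ => fderiv ℝ F ((ContinuousLinearMap.pi fun q : ↥B => ContinuousLinearMap.proj (R := ℝ) (φ := fun _ : ↥S => Fin (lieDim r) → ℝ) ⟨q.1, hBS q.2⟩) y) (latticeMaxwellBlockBasis B (lieDim r) (p, a)))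
          (fun (q : ↥S) (b : Fin (lieDim r)) => plaqField r β U (q : ZdPlaquette 4) b)
          (fun (q : ↥S) (b : Fin (lieDim r)) => if b = a then plaquetteCurl (ω p) (q : ZdPlaquette 4) else 0) ∂μ) =
        ∑ t : ↥B × Fin (lieDim r), latticeMaxwellBlockCov B (lieDim r) (p, a) t *
          ∫ U, fderiv ℝ (fun y' => fderiv ℝ F y' (latticeMaxwellBlockBasis B (lieDim r) (p, a)))
            (fun (q : ↥B) (b : Fin (lieDim r)) => plaqField r β U (q : ZdPlaquette 4) b) (latticeMaxwellBlockBasis B (lieDim r) t) ∂μ := by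
      simp_rw [hder]
      rw [integral_finsetSum _ fun t _ => (hint (hcts t)).const_mul _]
      exact Finset.sum_congr rfl fun t _ => integral_const_mul _ _
    -- (ii) the field side splits off the background
    have hgc : Continuous fun U : LGConfig 4 G =>
        fderiv ℝ F (fun (q : ↥B) (b : Fin (lieDim r)) => plaqField r β U (q : ZdPlaquette 4) b) (latticeMaxwellBlockBasis B (lieDim r) (p, a)) :=
      ((hF.continuous_fderiv (by norm_num)).comp hYBc).clm_apply continuous_const
    have hZc : Continuous fun U : LGConfig 4 G => ∑ q ∈ S, plaquetteCurl (ω p) q * plaqField r β U q a :=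
      continuous_finsetSum _ fun q _ => continuous_const.mul (hYqc q a)
    have hI2 : (∫ U, fderiv ℝ F ((ContinuousLinearMap.pi fun q : ↥B => ContinuousLinearMap.proj (R := ℝ) (φ := fun _ : ↥S => Fin (lieDim r) → ℝ) ⟨q.1, hBS q.2⟩) (fun (q : ↥S) (b : Fin (lieDim r)) => plaqField r β U (q : ZdPlaquette 4) b))
          (latticeMaxwellBlockBasis B (lieDim r) (p, a)) * (∑ q ∈ S, plaquetteCurl (ω p) q * plaqField r β U q a) ∂μ) =
        (∫ U, plaqField r β U (p : ZdPlaquette 4) a *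
          fderiv ℝ F (fun (q : ↥B) (b : Fin (lieDim r)) => plaqField r β U (q : ZdPlaquette 4) b) (latticeMaxwellBlockBasis B (lieDim r) (p, a)) ∂μ) -
        ∫ U, fderiv ℝ F (fun (q : ↥B) (b : Fin (lieDim r)) => plaqField r β U (q : ZdPlaquette 4) b) (latticeMaxwellBlockBasis B (lieDim r) (p, a)) *
          (plaqField r β U (p : ZdPlaquette 4) a - ∑ q ∈ S, plaquetteCurl (ω p) q * plaqField r β U q a) ∂μ := by
      have i1 : Integrable (fun U : LGConfig 4 G => plaqField r β U (p : ZdPlaquette 4) a *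
          fderiv ℝ F (fun (q : ↥B) (b : Fin (lieDim r)) => plaqField r β U (q : ZdPlaquette 4) b)
            (latticeMaxwellBlockBasis B (lieDim r) (p, a))) μ := hint ((hYqc (p : ZdPlaquette 4) a).mul hgc)
      have i2 : Integrable (fun U : LGConfig 4 G =>
          fderiv ℝ F (fun (q : ↥B) (b : Fin (lieDim r)) => plaqField r β U (q : ZdPlaquette 4) b)
            (latticeMaxwellBlockBasis B (lieDim r) (p, a)) *
          (plaqField r β U (p : ZdPlaquette 4) a - ∑ q ∈ S, plaquetteCurl (ω p) q * plaqField r β U q a)) μ :=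
        hint (hgc.mul ((hYqc (p : ZdPlaquette 4) a).sub hZc))
      rw [← integral_sub i1 i2]
      refine integral_congr_ae (ae_of_all _ fun U => ?_)
      simp only [hres U]
      ring
    rw [← hI1]
    rw [hI2] at hR
    -- |A - C| ≤ |A - (C - Bg)| + |Bg|
    have hBg : |∫ U, fderiv ℝ F (fun (q : ↥B) (b : Fin (lieDim r)) => plaqField r β U (q : ZdPlaquette 4) b) (latticeMaxwellBlockBasis B (lieDim r) (p, a)) *
          (plaqField r β U (p : ZdPlaquette 4) a - ∑ q ∈ S, plaquetteCurl (ω p) q * plaqField r β U q a) ∂μ| ≤ ξ := by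
      refine (abs_integral_le_integral_abs).trans ?_
      have iabs : Integrable (fun U : LGConfig 4 G =>
          |plaqField r β U (p : ZdPlaquette 4) a - ∑ q ∈ S, plaquetteCurl (ω p) q * plaqField r β U q a|) μ :=
        hint ((hYqc (p : ZdPlaquette 4) a).sub hZc).abs
      refine le_trans (integral_mono_of_nonneg (ae_of_all _ fun U => abs_nonneg _) iabs (ae_of_all _ fun U => ?_)) (hX p a)
      dsimp only
      rw [abs_mul]
      calc |fderiv ℝ F (fun (q : ↥B) (b : Fin (lieDim r)) => plaqField r β U (q : ZdPlaquette 4) b) (latticeMaxwellBlockBasis B (lieDim r) (p, a))| *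
            |plaqField r β U (p : ZdPlaquette 4) a - ∑ q ∈ S, plaquetteCurl (ω p) q * plaqField r β U q a|
          ≤ 1 * |plaqField r β U (p : ZdPlaquette 4) a - ∑ q ∈ S, plaquetteCurl (ω p) q * plaqField r β U q a| :=
            mul_le_mul_of_nonneg_right (hh2 _) (abs_nonneg _)
        _ = _ := one_mul _
    have hWp : (∑ e ∈ E p, |ω p e|) * (εsd * (1 + M)) ≤ W * (εsd * (1 + M)) :=
      mul_le_mul_of_nonneg_right (hW p) (by positivity)
    have htri := abs_sub_le
      (∫ U, fderiv ℝ (fun y : ↥S → Fin (lieDim r) → ℝ => fderiv ℝ F ((ContinuousLinearMap.pi fun q : ↥B => ContinuousLinearMap.proj (R := ℝ) (φ := fun _ : ↥S => Fin (lieDim r) → ℝ) ⟨q.1, hBS q.2⟩) y) (latticeMaxwellBlockBasis B (lieDim r) (p, a)))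
          (fun (q : ↥S) (b : Fin (lieDim r)) => plaqField r β U (q : ZdPlaquette 4) b)
          (fun (q : ↥S) (b : Fin (lieDim r)) => if b = a then plaquetteCurl (ω p) (q : ZdPlaquette 4) else 0) ∂μ)
      ((∫ U, plaqField r β U (p : ZdPlaquette 4) a *
          fderiv ℝ F (fun (q : ↥B) (b : Fin (lieDim r)) => plaqField r β U (q : ZdPlaquette 4) b) (latticeMaxwellBlockBasis B (lieDim r) (p, a)) ∂μ) -
        ∫ U, fderiv ℝ F (fun (q : ↥B) (b : Fin (lieDim r)) => plaqField r β U (q : ZdPlaquette 4) b) (latticeMaxwellBlockBasis B (lieDim r) (p, a)) *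
          (plaqField r β U (p : ZdPlaquette 4) a - ∑ q ∈ S, plaquetteCurl (ω p) q * plaqField r β U q a) ∂μ)
      (∫ U, plaqField r β U (p : ZdPlaquette 4) a *
          fderiv ℝ F (fun (q : ↥B) (b : Fin (lieDim r)) => plaqField r β U (q : ZdPlaquette 4) b) (latticeMaxwellBlockBasis B (lieDim r) (p, a)) ∂μ)
    have hlast : |((∫ U, plaqField r β U (p : ZdPlaquette 4) a *
          fderiv ℝ F (fun (q : ↥B) (b : Fin (lieDim r)) => plaqField r β U (q : ZdPlaquette 4) b) (latticeMaxwellBlockBasis B (lieDim r) (p, a)) ∂μ) -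
        ∫ U, fderiv ℝ F (fun (q : ↥B) (b : Fin (lieDim r)) => plaqField r β U (q : ZdPlaquette 4) b) (latticeMaxwellBlockBasis B (lieDim r) (p, a)) *
          (plaqField r β U (p : ZdPlaquette 4) a - ∑ q ∈ S, plaquetteCurl (ω p) q * plaqField r β U q a) ∂μ) -
        ∫ U, plaqField r β U (p : ZdPlaquette 4) a *
          fderiv ℝ F (fun (q : ↥B) (b : Fin (lieDim r)) => plaqField r β U (q : ZdPlaquette 4) b) (latticeMaxwellBlockBasis B (lieDim r) (p, a)) ∂μ| ≤ ξ := by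
      rw [show ∀ x y : ℝ, x - y - x = -y from fun x y => by ring, abs_neg]
      exact hBg
    linarith [hR, hWp, htri, hlast]
  -- expand the generator integral
  have hpartc : ∀ s t : ↥B × Fin (lieDim r), Continuous fun U : LGConfig 4 G =>
      fderiv ℝ (fun y' => fderiv ℝ F y' (latticeMaxwellBlockBasis B (lieDim r) s))
        (fun (q : ↥B) (b : Fin (lieDim r)) => plaqField r β U (q : ZdPlaquette 4) b) (latticeMaxwellBlockBasis B (lieDim r) t) := fun s t => by
    obtain ⟨hh1, -, -⟩ := partial_props hF hF1 hM hF2 s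
    exact ((hh1.continuous_fderiv one_ne_zero).comp hYBc).clm_apply continuous_const
  have hgsc : ∀ s : ↥B × Fin (lieDim r), Continuous fun U : LGConfig 4 G =>
      fderiv ℝ F (fun (q : ↥B) (b : Fin (lieDim r)) => plaqField r β U (q : ZdPlaquette 4) b) (latticeMaxwellBlockBasis B (lieDim r) s) := fun s =>
    ((hF.continuous_fderiv (by norm_num)).comp hYBc).clm_apply continuous_const
  have hsplit : (∫ U, latticeMaxwellBlockGenerator B (lieDim r) F (fun (p : ↥B) (a : Fin (lieDim r)) => plaqField r β U (p : ZdPlaquette 4) a) ∂μ) =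
      ∑ s : ↥B × Fin (lieDim r), ((∑ t : ↥B × Fin (lieDim r), latticeMaxwellBlockCov B (lieDim r) s t *
          ∫ U, fderiv ℝ (fun y' => fderiv ℝ F y' (latticeMaxwellBlockBasis B (lieDim r) s))
            (fun (q : ↥B) (b : Fin (lieDim r)) => plaqField r β U (q : ZdPlaquette 4) b) (latticeMaxwellBlockBasis B (lieDim r) t) ∂μ) -
        ∫ U, plaqField r β U (s.1 : ZdPlaquette 4) s.2 *
          fderiv ℝ F (fun (q : ↥B) (b : Fin (lieDim r)) => plaqField r β U (q : ZdPlaquette 4) b) (latticeMaxwellBlockBasis B (lieDim r) s) ∂μ) := by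
    have hpt : ∀ U : LGConfig 4 G,
        latticeMaxwellBlockGenerator B (lieDim r) F (fun (p : ↥B) (a : Fin (lieDim r)) => plaqField r β U (p : ZdPlaquette 4) a) =
          ∑ s : ↥B × Fin (lieDim r), ((∑ t : ↥B × Fin (lieDim r), latticeMaxwellBlockCov B (lieDim r) s t *
              fderiv ℝ (fun y' => fderiv ℝ F y' (latticeMaxwellBlockBasis B (lieDim r) s))
                (fun (q : ↥B) (b : Fin (lieDim r)) => plaqField r β U (q : ZdPlaquette 4) b) (latticeMaxwellBlockBasis B (lieDim r) t)) -
            plaqField r β U (s.1 : ZdPlaquette 4) s.2 *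
              fderiv ℝ F (fun (q : ↥B) (b : Fin (lieDim r)) => plaqField r β U (q : ZdPlaquette 4) b) (latticeMaxwellBlockBasis B (lieDim r) s)) := by
      intro U
      rw [latticeMaxwellBlockGenerator, fderiv_apply_self_eq_sum, ← Finset.sum_sub_distrib]
    simp_rw [hpt]
    have iA : ∀ s t : ↥B × Fin (lieDim r), Integrable (fun U : LGConfig 4 G => latticeMaxwellBlockCov B (lieDim r) s t *
        fderiv ℝ (fun y' => fderiv ℝ F y' (latticeMaxwellBlockBasis B (lieDim r) s))
          (fun (q : ↥B) (b : Fin (lieDim r)) => plaqField r β U (q : ZdPlaquette 4) b) (latticeMaxwellBlockBasis B (lieDim r) t)) μ :=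
      fun s t => hint ((continuous_const (y := latticeMaxwellBlockCov B (lieDim r) s t)).mul (hpartc s t))
    have iAs : ∀ s : ↥B × Fin (lieDim r), Integrable (fun U : LGConfig 4 G => ∑ t : ↥B × Fin (lieDim r),
        latticeMaxwellBlockCov B (lieDim r) s t *
          fderiv ℝ (fun y' => fderiv ℝ F y' (latticeMaxwellBlockBasis B (lieDim r) s))
            (fun (q : ↥B) (b : Fin (lieDim r)) => plaqField r β U (q : ZdPlaquette 4) b) (latticeMaxwellBlockBasis B (lieDim r) t)) μ :=
      fun s => integrable_finsetSum _ fun t _ => iA s t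
    have iC : ∀ s : ↥B × Fin (lieDim r), Integrable (fun U : LGConfig 4 G => plaqField r β U (s.1 : ZdPlaquette 4) s.2 *
        fderiv ℝ F (fun (q : ↥B) (b : Fin (lieDim r)) => plaqField r β U (q : ZdPlaquette 4) b) (latticeMaxwellBlockBasis B (lieDim r) s)) μ :=
      fun s => hint ((hYqc (s.1 : ZdPlaquette 4) s.2).mul (hgsc s))
    have iD : ∀ s : ↥B × Fin (lieDim r), Integrable (fun U : LGConfig 4 G => (∑ t : ↥B × Fin (lieDim r),
        latticeMaxwellBlockCov B (lieDim r) s t *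
          fderiv ℝ (fun y' => fderiv ℝ F y' (latticeMaxwellBlockBasis B (lieDim r) s))
            (fun (q : ↥B) (b : Fin (lieDim r)) => plaqField r β U (q : ZdPlaquette 4) b) (latticeMaxwellBlockBasis B (lieDim r) t)) -
        plaqField r β U (s.1 : ZdPlaquette 4) s.2 *
          fderiv ℝ F (fun (q : ↥B) (b : Fin (lieDim r)) => plaqField r β U (q : ZdPlaquette 4) b) (latticeMaxwellBlockBasis B (lieDim r) s)) μ :=
      fun s => (iAs s).sub (iC s)
    rw [integral_finsetSum _ fun s _ => iD s]
    refine Finset.sum_congr rfl fun s _ => ?_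
    rw [integral_sub (iAs s) (iC s), integral_finsetSum _ fun t _ => iA s t]
    refine congrArg₂ (· - ·) (Finset.sum_congr rfl fun t _ => integral_const_mul _ _) rfl
  rw [hsplit]
  refine (Finset.abs_sum_le_sum_abs _ _).trans ?_
  calc ∑ s : ↥B × Fin (lieDim r), |(∑ t : ↥B × Fin (lieDim r), latticeMaxwellBlockCov B (lieDim r) s t *
          ∫ U, fderiv ℝ (fun y' => fderiv ℝ F y' (latticeMaxwellBlockBasis B (lieDim r) s))
            (fun (q : ↥B) (b : Fin (lieDim r)) => plaqField r β U (q : ZdPlaquette 4) b) (latticeMaxwellBlockBasis B (lieDim r) t) ∂μ) -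
        ∫ U, plaqField r β U (s.1 : ZdPlaquette 4) s.2 *
          fderiv ℝ F (fun (q : ↥B) (b : Fin (lieDim r)) => plaqField r β U (q : ZdPlaquette 4) b) (latticeMaxwellBlockBasis B (lieDim r) s) ∂μ|
      ≤ ∑ _s : ↥B × Fin (lieDim r), (W * (εsd * (1 + M)) + ξ) := Finset.sum_le_sum fun s _ => key s
    _ = (B.card * lieDim r : ℝ) * (W * (εsd * (1 + M)) + ξ) := by
        rw [Finset.sum_const, Finset.card_univ, Fintype.card_prod, Fintype.card_coe, Fintype.card_fin, nsmul_eq_mul]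
        push_cast
        ring

end Generator

end AssemblyGen

end Summit.QuantumFields.YangMills.Cruxes.FreeProbeLawG.SteinFree

end
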